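import Summits.KontsevichZagierPeriods.KontsevichZagierPeriods.Theorems.HurwitzMicroSectorsHurwitzSectorComplementStubLadderEngineBase
import Summits.KontsevichZagierPeriods.KontsevichZagierPeriods.Theorems.HurwitzMicroSectorsHurwitzSectorComplementStubLadderEngineIntegrable
import Summits.KontsevichZagierPeriods.KontsevichZagierPeriods.Theorems.HurwitzMicroSectorsHurwitzSectorComplementStubLadderEngineReindex
import Summits.KontsevichZagierPeriods.KontsevichZagierPeriods.Theorems.LinRedNormalFormArrangementNormalFormStubIntegrateOutMoves

/-!
# Ladder engine: the T-step (crux `HurwitzSectorComplement`, line `chebyshev-level-deformation`, stub S1)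

Over `box^{m+2} × D` (weight `W(y)`, parameter `0 < lam(y) ≤ Λ`):
`[W·T(lam y, p)] − [W/(1−p)] + [W(tail y′)·ω(y′₀)·U(y′₀, p′)] ∈ KZ.relations`. Moves: (A) Fubini `ζ`-part,
(B) Newton–Leibniz in `y′₀ ∈ (0, lam y)` (primitive `W·T(y′₀,p)`, band domination `8M(1−p)^{−3/2}(y′₀)^{−1/2}`),
(C) additivity, (D) coordinate swap, (E) Newton–Leibniz in the last box coordinate (primitive
`−W ω(y′₀)·x·U(y′₀, p′x)`, certificate `∂ᵥT = −ω ∂ₛ(sU)`), (F) sign. [cite: KontsevichZagier2001, §1.2, rules (1)–(3)]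
-/

noncomputable section

open Set MeasureTheory
open Literature.NumberTheory.Transcendental
open Literature.ModelTheory.ExponentialFields (IsSemialgebraic)
open Summit.KontsevichZagierPeriods.ArrangementNormalForm.JanusBands.IntegrateOut (newtonLeibniz_pack)

namespace Summit.KontsevichZagierPeriods.Theorems.HurwitzMicroSectorsHurwitzSectorComplement.LadderEngine

set_option maxHeartbeats 800000 in -- six chained moves; default budget too small
/-- **The T-step of the Chebyshev ladder.** See the module docstring. [cite: KontsevichZagier2001, §1.2] -/
theorem tStep (m k : ℕ) (D : Set (Fin k → ℝ)) (W lam : (Fin k → ℝ) → ℝ) (M Λ : ℝ)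
    (hD : IsSemialgebraic ℚ D) (hDb : Bornology.IsBounded D)
    (hW : IsSemialgebraicFunOn ℚ D W) (hlam : IsSemialgebraicFunOn ℚ D lam)
    (hWM : ∀ y ∈ D, |W y| ≤ M) (hlamΛ : ∀ y ∈ D, 0 < lam y ∧ lam y ≤ Λ)
    (r : KZ.IntegralRep (m + 2 + k))
    (hrd : r.domain = {z | (∀ i : Fin (m + 2), z (Fin.castAdd k i) ∈ Set.Ioo (0:ℝ) 1) ∧
      (fun j : Fin k => z (Fin.natAdd (m + 2) j)) ∈ D})
    (hri : Set.EqOn r.integrand (fun z => W (fun j : Fin k => z (Fin.natAdd (m + 2) j)) *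
      (((1 - ∏ i : Fin (m + 2), z (Fin.castAdd k i)) -
          (lam (fun j : Fin k => z (Fin.natAdd (m + 2) j))) ^ 2 *
            (1 + ∏ i : Fin (m + 2), z (Fin.castAdd k i))) /
        ((1 - ∏ i : Fin (m + 2), z (Fin.castAdd k i)) ^ 2 +
          (lam (fun j : Fin k => z (Fin.natAdd (m + 2) j))) ^ 2 *
            (1 + ∏ i : Fin (m + 2), z (Fin.castAdd k i)) ^ 2))) r.domain) :
    ∃ (r₁ : KZ.IntegralRep (m + 2 + k)) (r₂ : KZ.IntegralRep (m + 1 + (k + 1))),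
      r₁.domain = r.domain ∧
      (r₁.integrand = fun z => W (fun j : Fin k => z (Fin.natAdd (m + 2) j)) /
        (1 - ∏ i : Fin (m + 2), z (Fin.castAdd k i))) ∧
      r₂.domain = {z | (∀ i : Fin (m + 1), z (Fin.castAdd (k + 1) i) ∈ Set.Ioo (0:ℝ) 1) ∧
        (fun j : Fin k => z (Fin.natAdd (m + 1) j.succ)) ∈ D ∧
        0 < z (Fin.natAdd (m + 1) 0) ∧
        z (Fin.natAdd (m + 1) 0) < lam (fun j : Fin k => z (Fin.natAdd (m + 1) j.succ))} ∧
      (r₂.integrand = fun z => W (fun j : Fin k => z (Fin.natAdd (m + 1) j.succ)) *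
        (2 / (1 + (z (Fin.natAdd (m + 1) 0)) ^ 2)) *
        (2 * z (Fin.natAdd (m + 1) 0) /
          ((1 - ∏ i : Fin (m + 1), z (Fin.castAdd (k + 1) i)) ^ 2 +
            (z (Fin.natAdd (m + 1) 0)) ^ 2 * (1 + ∏ i : Fin (m + 1), z (Fin.castAdd (k + 1) i)) ^ 2))) ∧
      KZ.of r - KZ.of r₁ + KZ.of r₂ ∈ KZ.relations := by
  /- ### notation -/
  set B : Set (Fin (m + 2 + k) → ℝ) := {z | (∀ i : Fin (m + 2), z (Fin.castAdd k i) ∈ Set.Ioo (0:ℝ) 1) ∧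
      (fun j : Fin k => z (Fin.natAdd (m + 2) j)) ∈ D} with hBdef
  have hBsa : IsSemialgebraic ℚ B := isSemialgebraic_base hD
  have hBm : MeasurableSet B := hrd ▸ KZ.IntegralRep.measurableSet_domain_holds r
  have hm2 : (m + 2) ≠ 0 := by omega
  have hp1 : ∀ z ∈ B, (∏ i : Fin (m + 2), z (Fin.castAdd k i)) ∈ Ioo (0:ℝ) 1 :=
    fun z hz => prod_base_mem_Ioo hm2 hz.1
  have hM0 : ∀ y ∈ D, (0:ℝ) ≤ M := fun y hy => (abs_nonneg _).trans (hWM y hy)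
  obtain ⟨RD, hRD⟩ := exists_forall_abs_apply_le hDb
  -- semialgebraic atoms on the base
  have hWB : IsSemialgebraicFunOn ℚ B (fun z => W fun j : Fin k => z (Fin.natAdd (m + 2) j)) :=
    isSemialgebraicFunOn_param_base hD hW
  have hlamB : IsSemialgebraicFunOn ℚ B (fun z => lam fun j : Fin k => z (Fin.natAdd (m + 2) j)) :=
    isSemialgebraicFunOn_param_base hD hlam
  have hpB : IsSemialgebraicFunOn ℚ B (fun z => ∏ i : Fin (m + 2), z (Fin.castAdd k i)) :=
    isSemialgebraicFunOn_prod_base hD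
  /- ### (A) the ζ-part `r₁ = [B, W/(1−p)]` -/
  have hg₁sa : IsSemialgebraicFunOn ℚ B (fun z => W (fun j : Fin k => z (Fin.natAdd (m + 2) j)) /
      (1 - ∏ i : Fin (m + 2), z (Fin.castAdd k i))) := by
    have h1 := isSemialgebraicFunOn_const_natCast hBsa 1
    simp only [Nat.cast_one] at h1
    exact hWB.fun_div' (h1.fun_sub hpB)
  have hg₁int : IntegrableOn (fun z => W (fun j : Fin k => z (Fin.natAdd (m + 2) j)) /
      (1 - ∏ i : Fin (m + 2), z (Fin.castAdd k i))) B := by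
    have hbox := integrableOn_box_one_sub_prod_rpow_neg (m + 2) (by omega) 1 (by norm_num)
      (by push_cast; linarith [(Nat.cast_nonneg m : (0:ℝ) ≤ m)])
    refine integrableOn_of_dominated_prod (n := m + 2) (d := k) hbox (integrableOn_const_of_isBounded hDb M)
      hBm (fun z hz => hz) (KZ.aestronglyMeasurable_of_isSemialgebraicFunOn hg₁sa hBm) fun z hz => ?_
    have hp := hp1 z hz
    have h1p : 0 < 1 - ∏ i : Fin (m + 2), z (Fin.castAdd k i) := by linarith [hp.2]
    beta_reduce
    rw [abs_div, abs_of_pos h1p, Rat.cast_one, Real.rpow_neg_one, div_eq_inv_mul]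
    exact mul_le_mul_of_nonneg_left (hWM _ hz.2) (inv_nonneg.mpr h1p.le)
  let r₁ : KZ.IntegralRep (m + 2 + k) := ⟨B, _, hBsa, hg₁sa, hg₁int⟩
  /- ### (B) the band of the first Newton–Leibniz move -/
  -- the integrand `f₁ = W · ∂ᵥT` and the primitive `F₁ = W · T` as functions on `ℝ^{m+2+k+1}`
  set f₁ : (Fin (m + 2 + k + 1) → ℝ) → ℝ := fun w =>
    W (fun j : Fin k => (Fin.init w : Fin (m + 2 + k) → ℝ) (Fin.natAdd (m + 2) j)) *
      (-(4 * w (Fin.last (m + 2 + k)) * (1 - (∏ i : Fin (m + 2), (Fin.init w : Fin (m + 2 + k) → ℝ) (Fin.castAdd k i)) ^ 2)) /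
        ((1 - ∏ i : Fin (m + 2), (Fin.init w : Fin (m + 2 + k) → ℝ) (Fin.castAdd k i)) ^ 2 +
          (w (Fin.last (m + 2 + k))) ^ 2 *
            (1 + ∏ i : Fin (m + 2), (Fin.init w : Fin (m + 2 + k) → ℝ) (Fin.castAdd k i)) ^ 2) ^ 2) with hf₁def
  set F₁ : (Fin (m + 2 + k + 1) → ℝ) → ℝ := fun w =>
    W (fun j : Fin k => (Fin.init w : Fin (m + 2 + k) → ℝ) (Fin.natAdd (m + 2) j)) *
      (((1 - ∏ i : Fin (m + 2), (Fin.init w : Fin (m + 2 + k) → ℝ) (Fin.castAdd k i)) -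
          (w (Fin.last (m + 2 + k))) ^ 2 * (1 + ∏ i : Fin (m + 2), (Fin.init w : Fin (m + 2 + k) → ℝ) (Fin.castAdd k i))) /
        ((1 - ∏ i : Fin (m + 2), (Fin.init w : Fin (m + 2 + k) → ℝ) (Fin.castAdd k i)) ^ 2 +
          (w (Fin.last (m + 2 + k))) ^ 2 *
            (1 + ∏ i : Fin (m + 2), (Fin.init w : Fin (m + 2 + k) → ℝ) (Fin.castAdd k i)) ^ 2)) with hF₁def
  -- semialgebraicity of `f₁`, `F₁` on any semialgebraic set over the base
  have hsa₁ : ∀ S : Set (Fin (m + 2 + k + 1) → ℝ), IsSemialgebraic ℚ S →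
      S ⊆ {w | (Fin.init w : Fin (m + 2 + k) → ℝ) ∈ B} →
      IsSemialgebraicFunOn ℚ S f₁ ∧ IsSemialgebraicFunOn ℚ S F₁ := by
    intro S hS hSB
    have hWS : IsSemialgebraicFunOn ℚ S
        (fun w => W fun j : Fin k => (Fin.init w : Fin (m + 2 + k) → ℝ) (Fin.natAdd (m + 2) j)) :=
      isSemialgebraicFunOn_param_initBand hD hW hS hSB
    have ht : IsSemialgebraicFunOn ℚ S (fun w => w (Fin.last (m + 2 + k))) := isSemialgebraicFunOn_apply hS _
    have hs : IsSemialgebraicFunOn ℚ S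
        (fun w => ∏ i : Fin (m + 2), (Fin.init w : Fin (m + 2 + k) → ℝ) (Fin.castAdd k i)) :=
      IsSemialgebraicFunOn.fun_finsetProd _ hS fun i _ =>
        isSemialgebraicFunOn_apply hS (Fin.castSucc (Fin.castAdd k i))
    exact ⟨hWS.fun_mul (isSemialgebraicFunOn_derivKernelT hS ht hs),
      hWS.fun_mul (isSemialgebraicFunOn_kernelT hS ht hs)⟩
  -- the open band and its rep
  set Band : Set (Fin (m + 2 + k + 1) → ℝ) := {w | (Fin.init w : Fin (m + 2 + k) → ℝ) ∈ B ∧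
      0 < w (Fin.last (m + 2 + k)) ∧
      w (Fin.last (m + 2 + k)) < lam (fun j : Fin k => (Fin.init w : Fin (m + 2 + k) → ℝ) (Fin.natAdd (m + 2) j))}
    with hBandDef
  have hBandSa : IsSemialgebraic ℚ Band := isSemialgebraic_openBand hD hlam
  have hBandM : MeasurableSet Band := IsSemialgebraic.measurableSet_holds hBandSa
  have hf₁sa : IsSemialgebraicFunOn ℚ Band f₁ := (hsa₁ Band hBandSa fun w hw => hw.1).1
  have hf₁int : IntegrableOn f₁ Band := by
    -- domination by `(1 − p)^{−3/2} ⊗ 8M (y′_last)^{−1/2}` on `box^{m+2} × D⁺_last`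
    have hbox := integrableOn_box_one_sub_prod_rpow_neg (m + 2) (by omega) (3/2) (by norm_num)
      (by push_cast; linarith [(show (2:ℝ) ≤ (m:ℝ) + 2 from by linarith [(Nat.cast_nonneg m : (0:ℝ) ≤ m)])])
    have hq : ((3/2 : ℚ) : ℝ) = (3/2 : ℝ) := by norm_num
    rw [hq] at hbox
    have hpar : IntegrableOn (fun y' : Fin (k + 1) → ℝ => 8 * M * (y' (Fin.last k)) ^ (-(1/2 : ℝ)))
        {y' : Fin (k + 1) → ℝ | (fun j : Fin k => y' (Fin.castSucc j)) ∈ D ∧ 0 < y' (Fin.last k) ∧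
          y' (Fin.last k) < lam (fun j : Fin k => y' (Fin.castSucc j))} := by
      refine (integrableOn_rpow_neg_apply (Fin.last k) (by norm_num : (1/2:ℝ) < 1) (max RD |Λ|)
        (fun y' hy' => hy'.2.1) fun y' hy' j => ?_).const_mul (8 * M)
      refine Fin.lastCases ?_ (fun j' => ?_) j
      · rw [abs_of_pos hy'.2.1]
        exact le_max_of_le_right ((hy'.2.2.le.trans (hlamΛ _ hy'.1).2).trans (le_abs_self Λ))
      · exact le_max_of_le_left (hRD _ hy'.1 j')
    refine integrableOn_of_dominated_prod (n := m + 2) (d := k + 1) hbox hpar hBandM ?_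
      (KZ.aestronglyMeasurable_of_isSemialgebraicFunOn hf₁sa hBandM) ?_
    · intro w hw
      refine ⟨fun i => hw.1.1 i, ?_, ?_, ?_⟩
      · exact hw.1.2
      · exact hw.2.1
      · exact hw.2.2
    · intro w hw
      have hz := hw.1
      have hprod : (∏ i : Fin (m + 2), (Fin.init w : Fin (m + 2 + k) → ℝ) (Fin.castAdd k i)) =
          ∏ i : Fin (m + 2), w (Fin.castAdd (k + 1) i) := Finset.prod_congr rfl fun i _ => rfl
      have hp := hp1 _ hz
      rw [hprod] at hp
      have ht0 : 0 < w (Fin.last (m + 2 + k)) := hw.2.1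
      have hker := abs_deriv_kernelT_le_rpow ht0 hp.1.le hp.2
      have hlast : w (Fin.natAdd (m + 2) (Fin.last k)) = w (Fin.last (m + 2 + k)) := rfl
      simp only [hf₁def, abs_mul, hprod, hlast]
      refine (mul_le_mul (hWM _ hz.2) hker (abs_nonneg _) (hM0 _ hz.2)).trans (le_of_eq ?_)
      ring
  let R₁ : KZ.IntegralRep (m + 2 + k + 1) := ⟨Band, f₁, hBandSa, hf₁sa, hf₁int⟩
  /- ### (B') Newton–Leibniz in the parameter -/
  have ha : IsSemialgebraicFunOn ℚ B (fun _ => (0:ℝ)) := by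
    simpa using isSemialgebraicFunOn_const_natCast hBsa 0
  have hab : ∀ z ∈ B, (fun _ => (0:ℝ)) z < lam (fun j : Fin k => z (Fin.natAdd (m + 2) j)) :=
    fun z hz => (hlamΛ _ hz.2).1
  have hclosed := hsa₁ (KZlog.band B (fun _ => (0:ℝ)) fun z => lam (fun j : Fin k => z (Fin.natAdd (m + 2) j)))
    (KZlog.isSemialgebraic_band ha hlamB) fun w hw => hw.1
  have hF₁snoc : ∀ (z : Fin (m + 2 + k) → ℝ) (t : ℝ), F₁ (Fin.snoc z t) =
      W (fun j : Fin k => z (Fin.natAdd (m + 2) j)) *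
        (((1 - ∏ i : Fin (m + 2), z (Fin.castAdd k i)) - t ^ 2 * (1 + ∏ i : Fin (m + 2), z (Fin.castAdd k i))) /
          ((1 - ∏ i : Fin (m + 2), z (Fin.castAdd k i)) ^ 2 + t ^ 2 * (1 + ∏ i : Fin (m + 2), z (Fin.castAdd k i)) ^ 2)) := by
    intro z t; simp only [hF₁def, Fin.init_snoc, Fin.snoc_last]
  have hf₁snoc : ∀ (z : Fin (m + 2 + k) → ℝ) (t : ℝ), f₁ (Fin.snoc z t) =
      W (fun j : Fin k => z (Fin.natAdd (m + 2) j)) *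
        (-(4 * t * (1 - (∏ i : Fin (m + 2), z (Fin.castAdd k i)) ^ 2)) /
          ((1 - ∏ i : Fin (m + 2), z (Fin.castAdd k i)) ^ 2 + t ^ 2 * (1 + ∏ i : Fin (m + 2), z (Fin.castAdd k i)) ^ 2) ^ 2) := by
    intro z t; simp only [hf₁def, Fin.init_snoc, Fin.snoc_last]
  have hcont₁ : ∀ z ∈ B, ContinuousOn (fun t : ℝ => F₁ (Fin.snoc z t))
      (Icc ((fun _ => (0:ℝ)) z) (lam (fun j : Fin k => z (Fin.natAdd (m + 2) j)))) := by
    intro z hz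
    have hfun : (fun t : ℝ => F₁ (Fin.snoc z t)) = fun t => W (fun j : Fin k => z (Fin.natAdd (m + 2) j)) *
        (((1 - ∏ i : Fin (m + 2), z (Fin.castAdd k i)) - t ^ 2 * (1 + ∏ i : Fin (m + 2), z (Fin.castAdd k i))) /
          ((1 - ∏ i : Fin (m + 2), z (Fin.castAdd k i)) ^ 2 + t ^ 2 * (1 + ∏ i : Fin (m + 2), z (Fin.castAdd k i)) ^ 2)) :=
      funext fun t => hF₁snoc z t
    rw [hfun]
    exact (continuous_const.mul (continuous_kernelT_param (hp1 z hz).2.ne)).continuousOn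
  have hder₁ : ∀ z ∈ B, ∀ t ∈ Ioo ((fun _ => (0:ℝ)) z) (lam (fun j : Fin k => z (Fin.natAdd (m + 2) j))),
      HasDerivAt (fun s : ℝ => F₁ (Fin.snoc z s)) (f₁ (Fin.snoc z t)) t := by
    intro z hz t _
    have hfun : (fun s : ℝ => F₁ (Fin.snoc z s)) = fun s => W (fun j : Fin k => z (Fin.natAdd (m + 2) j)) *
        (((1 - ∏ i : Fin (m + 2), z (Fin.castAdd k i)) - s ^ 2 * (1 + ∏ i : Fin (m + 2), z (Fin.castAdd k i))) /
          ((1 - ∏ i : Fin (m + 2), z (Fin.castAdd k i)) ^ 2 + s ^ 2 * (1 + ∏ i : Fin (m + 2), z (Fin.castAdd k i)) ^ 2)) :=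
      funext fun s => hF₁snoc z s
    rw [hfun, hf₁snoc]
    exact HasDerivAt.const_mul _ (hasDerivAt_kernelT_param t (hp1 z hz).2.ne)
  obtain ⟨r₁', hr₁'d, hr₁'i, hrelB⟩ := newtonLeibniz_pack hBsa ha hlamB hab hclosed.1 hclosed.2 hcont₁ hder₁
    R₁ rfl (fun _ _ => rfl)
  /- ### (C) integrand additivity: `[r] = [r₁'] + [r₁]` -/
  have hr₁d : r₁.domain = r.domain := hrd.symm
  have hrelC : KZ.of r - KZ.of r₁' - KZ.of r₁ ∈ KZ.relations := by
    refine KZ.integrandAddRel_subset_relations ⟨_, r, r₁', r₁, by rw [hr₁'d, hrd], hr₁d, ?_, rfl⟩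
    intro z hz
    rw [hrd] at hz
    have hp := hp1 z hz
    have h1p : (1 - ∏ i : Fin (m + 2), z (Fin.castAdd k i)) ≠ 0 := by linarith [hp.2]
    rw [hri (by rw [hrd]; exact hz)]
    change _ = r₁'.integrand z + W (fun j : Fin k => z (Fin.natAdd (m + 2) j)) /
      (1 - ∏ i : Fin (m + 2), z (Fin.castAdd k i))
    rw [hr₁'i]
    simp only [hF₁snoc]
    rw [kernelT_zero hp.2.ne]
    have hden := (den_pos (lam (fun j : Fin k => z (Fin.natAdd (m + 2) j))) hp.2.ne).ne'
    field_simp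
    ring
  /- ### (D) the coordinate swap -/
  let R₂ : KZ.IntegralRep (m + 1 + (k + 1) + 1) := R₁.reindex
    ((Equiv.swap (Fin.castSucc (Fin.castAdd k (Fin.last (m + 1)))) (Fin.last (m + 2 + k))).trans
      (finCongr (show m + 2 + k + 1 = m + 1 + (k + 1) + 1 by omega)))
  have hrelD : KZ.of R₁ - KZ.of R₂ ∈ KZ.relations := KZ.of_sub_of_reindex_mem_relations R₁ _
  -- the advanced base
  set B' : Set (Fin (m + 1 + (k + 1)) → ℝ) := {z | (∀ i : Fin (m + 1), z (Fin.castAdd (k + 1) i) ∈ Set.Ioo (0:ℝ) 1) ∧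
      (fun j : Fin k => z (Fin.natAdd (m + 1) j.succ)) ∈ D ∧
      0 < z (Fin.natAdd (m + 1) 0) ∧
      z (Fin.natAdd (m + 1) 0) < lam (fun j : Fin k => z (Fin.natAdd (m + 1) j.succ))} with hB'def
  have hB'sa : IsSemialgebraic ℚ B' :=
    KZ.isSemialgebraic_cylinder (KZ.isSemialgebraic_box (m + 1)) (isSemialgebraic_succParam hD hlam)
  have hR₂d : R₂.domain = {w' | (Fin.init w' : Fin (m + 1 + (k + 1)) → ℝ) ∈ B' ∧
      (fun _ => (0:ℝ)) (Fin.init w') < w' (Fin.last (m + 1 + (k + 1))) ∧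
      w' (Fin.last (m + 1 + (k + 1))) < (fun _ => (1:ℝ)) (Fin.init w')} := by
    ext w'
    exact reindex_band_iff D lam w'
  have hm1 : (m + 1) ≠ 0 := by omega
  have hp1' : ∀ z' ∈ B', (∏ i : Fin (m + 1), z' (Fin.castAdd (k + 1) i)) ∈ Ioo (0:ℝ) 1 :=
    fun z' hz' => prod_base_mem_Ioo hm1 hz'.1
  /- ### (E) Newton–Leibniz in the last box coordinate -/
  set f₂ : (Fin (m + 1 + (k + 1) + 1) → ℝ) → ℝ := fun w' =>
    W (fun j : Fin k => w' (Fin.castSucc (Fin.natAdd (m + 1) j.succ))) *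
      (-(4 * w' (Fin.castSucc (Fin.natAdd (m + 1) 0)) *
            (1 - ((∏ i : Fin (m + 1), w' (Fin.castSucc (Fin.castAdd (k + 1) i))) * w' (Fin.last (m + 1 + (k + 1)))) ^ 2)) /
        ((1 - (∏ i : Fin (m + 1), w' (Fin.castSucc (Fin.castAdd (k + 1) i))) * w' (Fin.last (m + 1 + (k + 1)))) ^ 2 +
          (w' (Fin.castSucc (Fin.natAdd (m + 1) 0))) ^ 2 *
            (1 + (∏ i : Fin (m + 1), w' (Fin.castSucc (Fin.castAdd (k + 1) i))) * w' (Fin.last (m + 1 + (k + 1)))) ^ 2) ^ 2)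
    with hf₂def
  set F₂ : (Fin (m + 1 + (k + 1) + 1) → ℝ) → ℝ := fun w' =>
    W (fun j : Fin k => w' (Fin.castSucc (Fin.natAdd (m + 1) j.succ))) *
      (-(2 / (1 + (w' (Fin.castSucc (Fin.natAdd (m + 1) 0))) ^ 2)) *
        (w' (Fin.last (m + 1 + (k + 1))) *
          (2 * w' (Fin.castSucc (Fin.natAdd (m + 1) 0)) /
            ((1 - (∏ i : Fin (m + 1), w' (Fin.castSucc (Fin.castAdd (k + 1) i))) * w' (Fin.last (m + 1 + (k + 1)))) ^ 2 +
              (w' (Fin.castSucc (Fin.natAdd (m + 1) 0))) ^ 2 *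
                (1 + (∏ i : Fin (m + 1), w' (Fin.castSucc (Fin.castAdd (k + 1) i))) * w' (Fin.last (m + 1 + (k + 1)))) ^ 2))))
    with hF₂def
  have hprod' : ∀ w' : Fin (m + 1 + (k + 1) + 1) → ℝ,
      (∏ i : Fin (m + 2), w' (((Equiv.swap (Fin.castSucc (Fin.castAdd k (Fin.last (m + 1)))) (Fin.last (m + 2 + k))).trans
          (finCongr (show m + 2 + k + 1 = m + 1 + (k + 1) + 1 by omega))) (Fin.castSucc (Fin.castAdd k i)))) =
        (∏ i : Fin (m + 1), w' (Fin.castSucc (Fin.castAdd (k + 1) i))) * w' (Fin.last (m + 1 + (k + 1))) :=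
    fun w' => by simpa using reindex_prod w'
  have hR₂i : EqOn R₂.integrand f₂ R₂.domain := by
    intro w' _
    change f₁ (fun idx => w' (((Equiv.swap (Fin.castSucc (Fin.castAdd k (Fin.last (m + 1)))) (Fin.last (m + 2 + k))).trans
          (finCongr (show m + 2 + k + 1 = m + 1 + (k + 1) + 1 by omega))) idx)) = f₂ w'
    simp only [hf₁def, hf₂def, Fin.init, reindex_apply_param, reindex_apply_bandVar, hprod']
  have hsa₂ : ∀ S : Set (Fin (m + 1 + (k + 1) + 1) → ℝ), IsSemialgebraic ℚ S →
      S ⊆ {w' | (Fin.init w' : Fin (m + 1 + (k + 1)) → ℝ) ∈ B'} →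
      IsSemialgebraicFunOn ℚ S f₂ ∧ IsSemialgebraicFunOn ℚ S F₂ := by
    intro S hS hSB
    have hWB' : IsSemialgebraicFunOn ℚ B' (fun z' => W fun j : Fin k => z' (Fin.natAdd (m + 1) j.succ)) :=
      KZ.isSemialgebraicFunOn_cylinder_right (KZ.isSemialgebraic_box (m + 1)) (isSemialgebraic_succParam hD hlam)
        (isSemialgebraicFunOn_comp_tail_succParam hD hlam hW)
    have hWS : IsSemialgebraicFunOn ℚ S (fun w' => W fun j : Fin k => w' (Fin.castSucc (Fin.natAdd (m + 1) j.succ))) :=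
      hWB'.comp_init_mono hS hSB
    have ht : IsSemialgebraicFunOn ℚ S (fun w' => w' (Fin.castSucc (Fin.natAdd (m + 1) 0))) :=
      isSemialgebraicFunOn_apply hS _
    have hx : IsSemialgebraicFunOn ℚ S (fun w' => w' (Fin.last (m + 1 + (k + 1)))) := isSemialgebraicFunOn_apply hS _
    have hp' : IsSemialgebraicFunOn ℚ S (fun w' => ∏ i : Fin (m + 1), w' (Fin.castSucc (Fin.castAdd (k + 1) i))) :=
      IsSemialgebraicFunOn.fun_finsetProd _ hS fun i _ => isSemialgebraicFunOn_apply hS _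
    have hs : IsSemialgebraicFunOn ℚ S
        (fun w' => (∏ i : Fin (m + 1), w' (Fin.castSucc (Fin.castAdd (k + 1) i))) * w' (Fin.last (m + 1 + (k + 1)))) :=
      hp'.fun_mul hx
    have hω : IsSemialgebraicFunOn ℚ S (fun w' => -(2 / (1 + (w' (Fin.castSucc (Fin.natAdd (m + 1) 0))) ^ 2))) := by
      have h1 := isSemialgebraicFunOn_const_natCast hS 1
      simp only [Nat.cast_one] at h1
      exact ((isSemialgebraicFunOn_const_ofNat hS 2).fun_div' (h1.fun_add (ht.fun_pow 2))).fun_neg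
    exact ⟨hWS.fun_mul (isSemialgebraicFunOn_derivKernelT hS ht hs),
      hWS.fun_mul (hω.fun_mul (hx.fun_mul (isSemialgebraicFunOn_kernelU hS ht hs)))⟩
  have ha₂ : IsSemialgebraicFunOn ℚ B' (fun _ => (0:ℝ)) := by simpa using isSemialgebraicFunOn_const_natCast hB'sa 0
  have hb₂ : IsSemialgebraicFunOn ℚ B' (fun _ => (1:ℝ)) := by simpa using isSemialgebraicFunOn_const_natCast hB'sa 1
  have hab₂ : ∀ z' ∈ B', (fun _ => (0:ℝ)) z' < (fun _ => (1:ℝ)) z' := fun _ _ => zero_lt_one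
  have hclosed₂ := hsa₂ (KZlog.band B' (fun _ => (0:ℝ)) fun _ => (1:ℝ)) (KZlog.isSemialgebraic_band ha₂ hb₂)
    fun w' hw' => hw'.1
  have hF₂snoc : ∀ (z' : Fin (m + 1 + (k + 1)) → ℝ) (x : ℝ), F₂ (Fin.snoc z' x) =
      W (fun j : Fin k => z' (Fin.natAdd (m + 1) j.succ)) * (-(2 / (1 + (z' (Fin.natAdd (m + 1) 0)) ^ 2)) *
        (x * (2 * z' (Fin.natAdd (m + 1) 0) /
          ((1 - (∏ i : Fin (m + 1), z' (Fin.castAdd (k + 1) i)) * x) ^ 2 +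
            (z' (Fin.natAdd (m + 1) 0)) ^ 2 * (1 + (∏ i : Fin (m + 1), z' (Fin.castAdd (k + 1) i)) * x) ^ 2)))) := by
    intro z' x; simp only [hF₂def, Fin.snoc_castSucc, Fin.snoc_last]
  have hf₂snoc : ∀ (z' : Fin (m + 1 + (k + 1)) → ℝ) (x : ℝ), f₂ (Fin.snoc z' x) =
      W (fun j : Fin k => z' (Fin.natAdd (m + 1) j.succ)) *
        (-(4 * z' (Fin.natAdd (m + 1) 0) * (1 - ((∏ i : Fin (m + 1), z' (Fin.castAdd (k + 1) i)) * x) ^ 2)) /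
          ((1 - (∏ i : Fin (m + 1), z' (Fin.castAdd (k + 1) i)) * x) ^ 2 +
            (z' (Fin.natAdd (m + 1) 0)) ^ 2 * (1 + (∏ i : Fin (m + 1), z' (Fin.castAdd (k + 1) i)) * x) ^ 2) ^ 2) := by
    intro z' x; simp only [hf₂def, Fin.snoc_castSucc, Fin.snoc_last]
  have hcont₂ : ∀ z' ∈ B', ContinuousOn (fun x : ℝ => F₂ (Fin.snoc z' x)) (Icc ((fun _ => (0:ℝ)) z') ((fun _ => (1:ℝ)) z')) := by
    intro z' hz'
    have hp := hp1' z' hz'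
    have hfun := funext fun x => hF₂snoc z' x
    rw [hfun]
    exact continuousOn_const.mul (continuousOn_const.mul
      (continuousOn_mul_kernelU (z' (Fin.natAdd (m + 1) 0)) hp.1.le hp.2))
  have hder₂ : ∀ z' ∈ B', ∀ x ∈ Ioo ((fun _ => (0:ℝ)) z') ((fun _ => (1:ℝ)) z'),
      HasDerivAt (fun s : ℝ => F₂ (Fin.snoc z' s)) (f₂ (Fin.snoc z' x)) x := by
    intro z' hz' x hx
    have hp := hp1' z' hz'
    have hpx : (∏ i : Fin (m + 1), z' (Fin.castAdd (k + 1) i)) * x ≠ 1 := by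
      have h1 : (∏ i : Fin (m + 1), z' (Fin.castAdd (k + 1) i)) * x < 1 * 1 :=
        mul_lt_mul'' hp.2 hx.2 hp.1.le hx.1.le
      linarith
    have hω0 : (1 + (z' (Fin.natAdd (m + 1) 0)) ^ 2) ≠ 0 := by positivity
    have hfun := funext fun s => hF₂snoc z' s
    rw [hfun, hf₂snoc]
    have hd := ((hasDerivAt_mul_kernelU (z' (Fin.natAdd (m + 1) 0)) (∏ i : Fin (m + 1), z' (Fin.castAdd (k + 1) i)) x hpx).const_mul
      (-(2 / (1 + (z' (Fin.natAdd (m + 1) 0)) ^ 2)))).const_mul (W (fun j : Fin k => z' (Fin.natAdd (m + 1) j.succ)))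
    refine hd.congr_deriv ?_
    have hden := (den_pos (z' (Fin.natAdd (m + 1) 0)) hpx).ne'
    field_simp
    ring
  obtain ⟨r₃, hr₃d, hr₃i, hrelE⟩ := newtonLeibniz_pack hB'sa ha₂ hb₂ hab₂ hclosed₂.1 hclosed₂.2 hcont₂ hder₂
    R₂ hR₂d hR₂i
  /- ### (F) the output representation (sign) -/
  have hneg : EqOn (fun z' : Fin (m + 1 + (k + 1)) → ℝ => W (fun j : Fin k => z' (Fin.natAdd (m + 1) j.succ)) *
        (2 / (1 + (z' (Fin.natAdd (m + 1) 0)) ^ 2)) *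
        (2 * z' (Fin.natAdd (m + 1) 0) /
          ((1 - ∏ i : Fin (m + 1), z' (Fin.castAdd (k + 1) i)) ^ 2 +
            (z' (Fin.natAdd (m + 1) 0)) ^ 2 * (1 + ∏ i : Fin (m + 1), z' (Fin.castAdd (k + 1) i)) ^ 2)))
      (-r₃.integrand) r₃.domain := by
    intro z' _
    simp only [Pi.neg_apply, hr₃i, hF₂snoc, mul_one, mul_zero, zero_mul, sub_zero]
    ring
  have hsub₃ : B' ⊆ r₃.domain := fun z hz => by rw [hr₃d]; exact hz
  let r₂ : KZ.IntegralRep (m + 1 + (k + 1)) := ⟨B', _, hB'sa,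
    (r₃.isSemialgebraicFunOn_integrand.neg.congr (fun z' hz' => (hneg hz').symm)).mono hsub₃ hB'sa,
    ((r₃.integrableOn.neg).congr_fun (fun z' hz' => (hneg hz').symm)
      (KZ.IntegralRep.measurableSet_domain_holds r₃)).mono_set hsub₃⟩
  have hrelF : KZ.of r₃ + KZ.of r₂ ∈ KZ.relations :=
    KZ.of_add_of_mem_relations_of_eqOn_neg hr₃d.symm hneg
  /- ### (G) assembly -/
  refine ⟨r₁, r₂, hr₁d, rfl, rfl, rfl, ?_⟩
  have : KZ.of r - KZ.of r₁ + KZ.of r₂ =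
      (KZ.of r - KZ.of r₁' - KZ.of r₁) - (KZ.of R₁ - KZ.of r₁') + (KZ.of R₁ - KZ.of R₂) + (KZ.of R₂ - KZ.of r₃) +
        (KZ.of r₃ + KZ.of r₂) := by abel
  rw [this]
  exact KZ.relations.add_mem (KZ.relations.add_mem (KZ.relations.add_mem
    (KZ.relations.sub_mem hrelC hrelB) hrelD) hrelE) hrelF

end Summit.KontsevichZagierPeriods.Theorems.HurwitzMicroSectorsHurwitzSectorComplement.LadderEngine

namespace Summit.KontsevichZagierPeriods.Theorems.HurwitzMicroSectorsHurwitzSectorComplement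

/-- **S1, T-step** in the registered closed form (first conjunct of `stub_ladderEngine`):
`[W·T(lam,p)] − [W/(1−p)] + [W·ω(y₀)·U(y₀,p′)] ∈ KZ.relations`. [cite: KontsevichZagier2001, §1.2] -/
theorem ladderEngine_tStep :
    ∀ (m k : ℕ) (D : Set (Fin k → ℝ)) (W lam : (Fin k → ℝ) → ℝ) (M Λ : ℝ),
      Literature.ModelTheory.ExponentialFields.IsSemialgebraic ℚ D → Bornology.IsBounded D →
      IsSemialgebraicFunOn ℚ D W → IsSemialgebraicFunOn ℚ D lam →
      (∀ y ∈ D, |W y| ≤ M) → (∀ y ∈ D, 0 < lam y ∧ lam y ≤ Λ) →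
      ∀ (r : KZ.IntegralRep (m + 2 + k)),
        r.domain = {z | (∀ i : Fin (m + 2), z (Fin.castAdd k i) ∈ Set.Ioo (0:ℝ) 1) ∧
          (fun j : Fin k => z (Fin.natAdd (m + 2) j)) ∈ D} →
        Set.EqOn r.integrand (fun z => W (fun j : Fin k => z (Fin.natAdd (m + 2) j)) *
          (((1 - ∏ i : Fin (m + 2), z (Fin.castAdd k i)) -
              (lam (fun j : Fin k => z (Fin.natAdd (m + 2) j))) ^ 2 *
                (1 + ∏ i : Fin (m + 2), z (Fin.castAdd k i))) /
            ((1 - ∏ i : Fin (m + 2), z (Fin.castAdd k i)) ^ 2 +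
              (lam (fun j : Fin k => z (Fin.natAdd (m + 2) j))) ^ 2 *
                (1 + ∏ i : Fin (m + 2), z (Fin.castAdd k i)) ^ 2))) r.domain →
        ∃ (r₁ : KZ.IntegralRep (m + 2 + k)) (r₂ : KZ.IntegralRep (m + 1 + (k + 1))),
          r₁.domain = r.domain ∧
          (r₁.integrand = fun z => W (fun j : Fin k => z (Fin.natAdd (m + 2) j)) /
            (1 - ∏ i : Fin (m + 2), z (Fin.castAdd k i))) ∧
          r₂.domain = {z | (∀ i : Fin (m + 1), z (Fin.castAdd (k + 1) i) ∈ Set.Ioo (0:ℝ) 1) ∧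
            (fun j : Fin k => z (Fin.natAdd (m + 1) j.succ)) ∈ D ∧
            0 < z (Fin.natAdd (m + 1) 0) ∧
            z (Fin.natAdd (m + 1) 0) < lam (fun j : Fin k => z (Fin.natAdd (m + 1) j.succ))} ∧
          (r₂.integrand = fun z => W (fun j : Fin k => z (Fin.natAdd (m + 1) j.succ)) *
            (2 / (1 + (z (Fin.natAdd (m + 1) 0)) ^ 2)) *
            (2 * z (Fin.natAdd (m + 1) 0) /
              ((1 - ∏ i : Fin (m + 1), z (Fin.castAdd (k + 1) i)) ^ 2 +
                (z (Fin.natAdd (m + 1) 0)) ^ 2 * (1 + ∏ i : Fin (m + 1), z (Fin.castAdd (k + 1) i)) ^ 2))) ∧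
          KZ.of r - KZ.of r₁ + KZ.of r₂ ∈ KZ.relations :=
  fun m k D W lam M Λ hD hDb hW hlam hWM hlamΛ r hrd hri =>
    LadderEngine.tStep m k D W lam M Λ hD hDb hW hlam hWM hlamΛ r hrd hri

end Summit.KontsevichZagierPeriods.Theorems.HurwitzMicroSectorsHurwitzSectorComplement
end
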